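import Mathlib.AlgebraicGeometry.Morphisms.Immersion
import Mathlib.AlgebraicGeometry.Morphisms.FiniteType
import Literature.AlgebraicGeometry.Morphisms.UniversallyClosed
import HarnessLib

/-!
# Universally closed morphisms: the affine-space test — proofs, part 1 (Stacks 05JX, (3) ⇒ (2))

Sibling proof file of `Literature/AlgebraicGeometry/Morphisms/UniversallyClosed.lean`, which
vendors the named fact `Literature.AlgebraicGeometry.Morphisms.universallyClosed_iff_isClosedMap_affineSpaceMap`
(The Stacks Project, Tag 05JX = Limits of Schemes, Lemma 32.14.2, (1) ⇔ (3): a quasi-compact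
`f : X → S` is universally closed iff every `𝐀ⁿ × X → 𝐀ⁿ × S` is closed). The printed proof
of (3) ⇒ (1) goes (3) ⇒ (2) ⇒ (1) with

> (2) for every morphism `S' → S` which is locally of finite presentation the base change
> `X_{S'} → S'` is closed.

This file proves the step **(3) ⇒ (2)** (`Literature.AlgebraicGeometry.Morphisms.isClosedMap_pullback_snd_of_forall_isClosedMap_affineSpaceMap`),
in fact for every `S' → S` locally of finite *type* (the printed argument only uses a closed
immersion of an affine `S'` into some `𝐀ⁿ` over an affine open of `S`, which exists in that
generality). The remaining step (2) ⇒ (1) (Limits, Lemma 32.14.1 = Tag 05BD, an approximation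
argument, plus Schemes, Lemma 26.19.8) is not done here.

## Proof (Stacks, loc. cit.)

«We may of course assume that `T` is affine and maps into an affine open `V` of `S` (since
`X_T → T` being closed is local on `T`). In this case there exists a closed immersion
`T → 𝐀ⁿ × V` […]. Then `T → 𝐀ⁿ × S` is a locally closed immersion. Hence we get a cartesian
diagram `X_T → 𝐀ⁿ × X`, `T → 𝐀ⁿ × S` […] where the horizontal arrows are locally closed
immersions. Hence any closed subset `Z ⊂ X_T` can be written as `X_T ∩ Z'` for some closed
subset `Z' ⊂ 𝐀ⁿ × X`. Then `f_T(Z) = T ∩ f_n(Z')` and we see that if `f_n` is closed, then also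
`f_T` is closed.»

* `isClosedMap_pullback_snd_of_isImmersion`: the last two sentences, for any immersion
  `i : T → 𝔸(n; S)` (immersions are topological embeddings, Mathlib `Scheme.Hom.isEmbedding`;
  points of fibre products, `Scheme.Pullback.exists_preimage_pullback`).
* `exists_isClosedImmersion_affineSpace`: a ring map `A → B` of finite type gives a closed
  immersion `Spec B → 𝔸(ι; Spec A)` over `Spec A` (`Algebra.FiniteType.iff_quotient_mvPolynomial'`,
  `IsClosedImmersion.spec_of_surjective`, `AffineSpace.SpecIso`).
* `isClosedMap_pullback_snd_affine`: the case `T = Spec B → Spec A ⊆ S`, identifying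
  `X ×_S T` with `𝔸(n; X) ×_{𝔸(n; S)} T` by pasting with `AffineSpace.isPullback_map`.
* `isClosedMap_pullback_snd_of_forall_isClosedMap_affineSpaceMap`: closedness is Zariski-local
  on the target (Mathlib `isClosedMap_isZariskiLocalAtTarget`), for the open cover of `T` by
  affine opens of the preimages of the affine charts of `S`.

## References

* The Stacks Project, Tag 05JX (Limits, Lemma 32.14.2), proof of (3) ⇒ (2). [StacksProject]
-/

noncomputable section

universe u

open CategoryTheory AlgebraicGeometry Topology TopologicalSpace Limits

namespace Literature.AlgebraicGeometry.Morphisms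

/-- **Base change of a closed `𝔸(n; X) → 𝔸(n; S)` along an immersion is closed** (the core of
Stacks 05JX (3) ⇒ (2)): if `f_n : 𝔸(n; X) → 𝔸(n; S)` is a closed map and `i : T → 𝔸(n; S)` an
immersion, then `pr₂ : 𝔸(n; X) ×_{𝔸(n; S)} T → T` is a closed map: the first projection `e`
is an immersion, hence an embedding, so a closed `Z` is `e⁻¹(Z')` with `Z' = closure e(Z)`, and
`pr₂(Z) = i⁻¹(f_n(Z'))`. [cite: StacksProject, Tag 05JX (Limits, Lemma 32.14.2), proof of (3) ⇒ (2)] -/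
theorem isClosedMap_pullback_snd_of_isImmersion {X S T : Scheme.{u}} (f : X ⟶ S) (n : Type u)
    (H : IsClosedMap (AffineSpace.map n f)) (i : T ⟶ 𝔸(n; S)) [IsImmersion i] :
    IsClosedMap (pullback.snd (AffineSpace.map n f) i) := by
  intro Z hZ
  have he : IsEmbedding (pullback.fst (AffineSpace.map n f) i) :=
    (pullback.fst (AffineSpace.map n f) i).isEmbedding
  set e := pullback.fst (AffineSpace.map n f) i with he_def
  set p := pullback.snd (AffineSpace.map n f) i with hp_def
  -- `Z = e⁻¹(closure e(Z))`
  have hZ' : Z = e ⁻¹' closure (e '' Z) := by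
    rw [← he.closure_eq_preimage_closure_image, hZ.closure_eq]
  -- `p(Z) = i⁻¹(f_n(closure e(Z)))`
  have himage : p '' Z = i ⁻¹' (AffineSpace.map n f '' closure (e '' Z)) := by
    ext t
    constructor
    · rintro ⟨z, hz, rfl⟩
      refine ⟨e z, subset_closure ⟨z, hz, rfl⟩, ?_⟩
      change (e ≫ AffineSpace.map n f) z = (p ≫ i) z
      rw [pullback.condition]
    · rintro ⟨z', hz', hzt⟩
      obtain ⟨w, hw₁, hw₂⟩ := Scheme.Pullback.exists_preimage_pullback (f := AffineSpace.map n f)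
        (g := i) z' t hzt
      refine ⟨w, ?_, hw₂⟩
      rw [hZ']
      show e w ∈ closure (e '' Z)
      rw [hw₁]
      exact hz'
  rw [himage]
  exact (H _ isClosed_closure).preimage i.continuous

/-- **Affine schemes of finite type embed into affine spaces**: for a ring map `φ : A → B` of
finite type there are a finite `ι` and a closed immersion `Spec B → 𝔸(ι; Spec A)` over
`Spec A` (a presentation `A[xᵢ | i ∈ ι] ↠ B`). This is the closed immersion `T → 𝐀ⁿ × V` of
the Stacks proof (there via Morphisms, Lemma 29.22.2 for finite presentation; finite type
suffices for the closed immersion). [Stacks 05JX, proof; Hartshorne II Ex. 3.1–3.3] [folklore] -/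
theorem exists_isClosedImmersion_affineSpace {A B : CommRingCat.{u}} (φ : A ⟶ B)
    (hφ : φ.hom.FiniteType) :
    ∃ (ι : Type u) (_ : Finite ι) (c : Spec B ⟶ 𝔸(ι; Spec A)),
      IsClosedImmersion c ∧ c ≫ (𝔸(ι; Spec A) ↘ Spec A) = Spec.map φ := by
  algebraize [φ.hom]
  obtain ⟨ι, _, F, hF⟩ := Algebra.FiniteType.iff_quotient_mvPolynomial'.mp hφ
  refine ⟨ι, inferInstance,
    Spec.map (CommRingCat.ofHom F.toRingHom) ≫ (AffineSpace.SpecIso ι A).inv, ?_, ?_⟩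
  · have : IsClosedImmersion (Spec.map (CommRingCat.ofHom F.toRingHom)) :=
      IsClosedImmersion.spec_of_surjective _ hF
    infer_instance
  · rw [Category.assoc, AffineSpace.SpecIso_inv_over, ← Spec.map_comp]
    congr 1
    ext a
    change F (MvPolynomial.C a) = φ.hom a
    exact F.commutes a

/-- **Stacks 05JX (3) ⇒ (2), affine-local case**: for `ι : Spec A → S` an open immersion and
`g' : Spec B → Spec A` locally of finite type, if all `𝔸(n; X) → 𝔸(n; S)` are closed then
`X ×_S Spec B → Spec B` is closed: `Spec B → 𝔸(n; Spec A) → 𝔸(n; S)` is an immersion `i` over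
`S` (`exists_isClosedImmersion_affineSpace`; `AffineSpace.map n ι` is an open immersion), and
`X ×_S Spec B = 𝔸(n; X) ×_{𝔸(n; S)} Spec B` (pasting with Mathlib `AffineSpace.isPullback_map`),
so `isClosedMap_pullback_snd_of_isImmersion` applies.
[cite: StacksProject, Tag 05JX (Limits, Lemma 32.14.2), proof of (3) ⇒ (2)] -/
theorem isClosedMap_pullback_snd_affine {X S : Scheme.{u}} (f : X ⟶ S)
    (H : ∀ (n : Type u) [Finite n], IsClosedMap (AffineSpace.map n f))
    {A B : CommRingCat.{u}} (ι : Spec A ⟶ S) [IsOpenImmersion ι] (g' : Spec B ⟶ Spec A)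
    [LocallyOfFiniteType g'] : IsClosedMap (pullback.snd f (g' ≫ ι)) := by
  obtain ⟨φ, rfl⟩ := Spec.map_surjective g'
  have hφ : φ.hom.FiniteType := HasRingHomProperty.Spec_iff.mp ‹LocallyOfFiniteType (Spec.map φ)›
  obtain ⟨n, _, c, hc, hcomp⟩ := exists_isClosedImmersion_affineSpace φ hφ
  have : IsOpenImmersion (AffineSpace.map n ι) :=
    MorphismProperty.of_isPullback (P := @IsOpenImmersion)
      (AffineSpace.isPullback_map ι).flip ‹IsOpenImmersion ι›
  -- the immersion `i : Spec B → 𝔸(n; S)` over `S`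
  let i : Spec B ⟶ 𝔸(n; S) := c ≫ AffineSpace.map n ι
  have hi : i ≫ (𝔸(n; S) ↘ S) = Spec.map φ ≫ ι := by
    simp only [i, Category.assoc, AffineSpace.map_over]
    rw [← Category.assoc, hcomp]
  have : IsImmersion i := inferInstance
  -- `X ×_S Spec B = 𝔸(n; X) ×_{𝔸(n; S)} Spec B`
  have hP : IsPullback (pullback.fst (AffineSpace.map n f) i ≫ (𝔸(n; X) ↘ X))
      (pullback.snd (AffineSpace.map n f) i) f (Spec.map φ ≫ ι) := by
    rw [← hi]
    exact ((IsPullback.of_hasPullback (AffineSpace.map n f) i).flip.paste_vert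
      (AffineSpace.isPullback_map f)).flip
  have he : hP.isoPullback.inv ≫ pullback.snd (AffineSpace.map n f) i =
      pullback.snd f (Spec.map φ ≫ ι) := by
    rw [Iso.inv_comp_eq, IsPullback.isoPullback_hom_snd]
  rw [← he]
  have hcoe : (⇑(hP.isoPullback.inv ≫ pullback.snd (AffineSpace.map n f) i) :
      ↥(pullback f (Spec.map φ ≫ ι)) → ↥(Spec B)) =
      ⇑(pullback.snd (AffineSpace.map n f) i) ∘ ⇑hP.isoPullback.inv :=
    funext fun x ↦ Scheme.Hom.comp_apply _ _ x
  rw [hcoe]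
  exact (isClosedMap_pullback_snd_of_isImmersion f n (H n) i).comp
    (Scheme.homeoOfIso hP.isoPullback.symm).isClosedMap

/-- **Stacks 05JX (3) ⇒ (2)**: if `𝔸(n; X) → 𝔸(n; S)` is a closed map for every finite `n`, then
for every `g : T → S` locally of finite type (in particular for every `g` locally of finite
presentation, as printed) the base change `X ×_S T → T` is a closed map. Closedness is
Zariski-local on `T` (Mathlib `isClosedMap_isZariskiLocalAtTarget`); on an affine open `Spec B`
of the preimage of an affine chart `Spec A ⊆ S` this is `isClosedMap_pullback_snd_affine`
(via `(X ×_S T) ×_T Spec B = X ×_S Spec B`, Mathlib `pullbackLeftPullbackSndIso`). No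
quasi-compactness of `f` is needed for this step.
[cite: StacksProject, Tag 05JX (Limits, Lemma 32.14.2), (3) ⇒ (2)] -/
theorem isClosedMap_pullback_snd_of_forall_isClosedMap_affineSpaceMap {X S T : Scheme.{u}}
    (f : X ⟶ S) (H : ∀ (n : Type u) [Finite n], IsClosedMap (AffineSpace.map n f))
    (g : T ⟶ S) [LocallyOfFiniteType g] : IsClosedMap (pullback.snd f g) := by
  change (topologically @IsClosedMap) (pullback.snd f g)
  rw [IsZariskiLocalAtTarget.iff_of_openCover (P := topologically @IsClosedMap)
    ((S.affineCover.pullback₁ g).bind fun α ↦ ((S.affineCover.pullback₁ g).X α).affineCover)]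
  rintro ⟨α, β⟩
  -- the chart `w : Spec B → T` factors as `Spec B → Spec A → S` through the chart `α` of `S`
  set w : (pullback g (S.affineCover.f α)).affineCover.X β ⟶ T :=
    (pullback g (S.affineCover.f α)).affineCover.f β ≫ pullback.fst g (S.affineCover.f α) with hw
  have hg' : w ≫ g = ((pullback g (S.affineCover.f α)).affineCover.f β ≫
      pullback.snd g (S.affineCover.f α)) ≫ S.affineCover.f α := by
    simp only [hw, Category.assoc, pullback.condition]
  have : IsOpenImmersion ((pullback g (S.affineCover.f α)).affineCover.f β) :=
    (pullback g (S.affineCover.f α)).affineCover.map_prop β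
  have : LocallyOfFiniteType ((pullback g (S.affineCover.f α)).affineCover.f β ≫
      pullback.snd g (S.affineCover.f α)) := inferInstance
  have hloc : IsClosedMap (pullback.snd f (w ≫ g)) := by
    rw [hg']
    exact @isClosedMap_pullback_snd_affine _ _ f H _ _ (S.affineCover.f α)
      (S.affineCover.map_prop α) _ this
  change IsClosedMap (pullback.snd (pullback.snd f g) w)
  rw [← pullbackLeftPullbackSndIso_hom_snd f g w]
  have hcoe : (⇑((pullbackLeftPullbackSndIso f g w).hom ≫ pullback.snd f (w ≫ g)) :
      ↥(pullback (pullback.snd f g) w) → ↥((pullback g (S.affineCover.f α)).affineCover.X β)) =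
      ⇑(pullback.snd f (w ≫ g)) ∘ ⇑(pullbackLeftPullbackSndIso f g w).hom :=
    funext fun x ↦ Scheme.Hom.comp_apply _ _ x
  rw [hcoe]
  exact hloc.comp (Scheme.homeoOfIso (pullbackLeftPullbackSndIso f g w)).isClosedMap

/-- **Stacks 05JX (1) ⇔ (3) reduces to (2) ⇒ (1)**: given the named fact's remaining content
in the form "closedness of all base changes along morphisms locally of finite type implies
universal closedness (for `f` quasi-compact)" — this is (2) ⇒ (1) of Tag 05JX with finite type
for finite presentation — the named fact `universallyClosed_iff_isClosedMap_affineSpaceMap`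
follows from `isClosedMap_pullback_snd_of_forall_isClosedMap_affineSpaceMap` and
`isClosedMap_affineSpaceMap_of_universallyClosed`.
[cite: StacksProject, Tag 05JX (Limits, Lemma 32.14.2)] -/
theorem universallyClosed_iff_isClosedMap_affineSpaceMap_of
    (h21 : ∀ ⦃X S : Scheme.{u}⦄ (f : X ⟶ S) [QuasiCompact f],
      (∀ ⦃T : Scheme.{u}⦄ (g : T ⟶ S) [LocallyOfFiniteType g], IsClosedMap (pullback.snd f g)) →
        UniversallyClosed f) :
    universallyClosed_iff_isClosedMap_affineSpaceMap.{u} := by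
  intro X S f _
  refine ⟨fun _ n _ ↦ isClosedMap_affineSpaceMap_of_universallyClosed f n, fun H ↦ ?_⟩
  exact h21 f fun T g _ ↦ isClosedMap_pullback_snd_of_forall_isClosedMap_affineSpaceMap f H g

end Literature.AlgebraicGeometry.Morphisms

end
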